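import Literature.Topology.FourManifolds.CollarExtension
import Literature.Topology.FourManifolds.CollarTheorem
import HarnessLib

/-!
# Diffeotopies of the boundary extend to diffeotopies of the manifold (given a collar)

Topic `Literature/Topology/FourManifolds`.  `CollarExtension.lean` proves Hirsch's remark
(*Differential Topology* (1976), Ch. 8 §2, proof of Thm. 2.3): a boundary diffeomorphism
diffeotopic to the identity extends over `M`, by spreading the diffeotopy `F` of `∂M` over a
collar (`BoundaryData.Collar.slideExtension c F : M ≃ M`, extending the time-`1` stage `F₁`).
This file proves the **one-parameter form**: the whole diffeotopy `F_t` of `∂M` extends to a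
**diffeotopy** `G_t` of `M` with `G_t ∘ incl = incl ∘ F_t` for *all* `t`
(`BoundaryData.Collar.diffeotopyExtension`, `…exists_diffeotopy_comp_incl_eq`).  This is the
step *"extended over `M`, using the collar of `∂M`, in the usual way"* (Kosinski, *Differential
Manifolds* (1993), VI §7, proof of (7.2)) by which an isotopy of attaching spheres in `∂M`,
made ambient in `∂M` by the Isotopy Extension Theorem (II (5.2)), moves the rest of `M`
along — the input AMB of the isotopy invariance of handle attachment
(`Geometry/Symplectic/TwoHandleIsotopyReduction.lean`).

## Construction

For each `s` apply the slide extension to the rescaled diffeotopy `u ↦ F_{us}` (whose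
time-`1` stage is `F_s`): `G_s = slideExtension c (F_{·s})`, i.e. on the collar
`G_s (c (y, r)) = c (F_{β(r)s} y, r)` with the profile `β` of `CollarExtension.lean`, and
`G_s = id` off the lower half `c(∂M × [0, 1/2])`.  Joint smoothness of the track
`(s, p) ↦ (s, G_s p)` is proved exactly as the smoothness of one slide extension there: near
a point of the lower half by *descent along the open immersion* `id × c : ℝ × (∂M × [0, 1]) →
ℝ × M` (`contMDiffAt_of_comp_isImmersionAt_of_nhds`) of the explicit smooth map
`(s, (y, r)) ↦ (s, c (F_{β(r)s} y, r))`; elsewhere the track is locally the identity (the lower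
half is closed as `∂M` is compact).  Then `G_0 = id` (`F_0 = id`) and `G_s ∘ incl = incl ∘ F_s`
(`slideExtensionFun_incl`).  Everything is proved; no named facts.

## References

* A. A. Kosinski, *Differential Manifolds* (1993), VI §7, proof of (7.2); II (5.2). [Kosinski1993]
* M. W. Hirsch, *Differential Topology*, GTM 33 (1976), Ch. 8 §1 Thm. 1.6 (parameters), §2 proof
  of Thm. 2.3. [HirschDT1976]
-/

open scoped Manifold ContDiff Topology
open Set Function

noncomputable section

namespace Literature.Topology.FourManifolds

universe u

section General

variable {E H E₀ H₀ : Type*} [NormedAddCommGroup E] [NormedSpace ℝ E] [TopologicalSpace H]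
  [NormedAddCommGroup E₀] [NormedSpace ℝ E₀] [TopologicalSpace H₀]
  {I : ModelWithCorners ℝ E H} {M : Type u} [TopologicalSpace M] [ChartedSpace H M]
  {I₀ : ModelWithCorners ℝ E₀ H₀} {b : BoundaryData I M I₀}

namespace Diffeotopy

variable {N : Type*} [TopologicalSpace N] [ChartedSpace H₀ N]

/-- **Rescaling the time of a diffeotopy**: the diffeotopy `u ↦ F_{u s}`, whose time-`1`
stage is `F_s` (`Diffeotopy.reparam` along `u ↦ u s`). [folklore] -/
def rescale (D : Diffeotopy I₀ N) (s : ℝ) : Diffeotopy I₀ N :=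
  D.reparam (fun u => u * s) (contDiff_id.mul contDiff_const) (by simp)

/-- Stages of the rescaled diffeotopy. [folklore] -/
@[simp] theorem rescale_toFun (D : Diffeotopy I₀ N) (s u : ℝ) :
    (D.rescale s).toFun u = D.toFun (u * s) := rfl

/-- Inverse stages of the rescaled diffeotopy. [folklore] -/
@[simp] theorem rescale_invFun (D : Diffeotopy I₀ N) (s u : ℝ) :
    (D.rescale s).invFun u = D.invFun (u * s) := rfl

end Diffeotopy

namespace BoundaryData.Collar

variable (c : b.Collar) (D : Diffeotopy I₀ b.carrier)

/-! ### The track and its inverse -/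

/-- The track `(s, p) ↦ (s, G_s p)` of the extension, `G_s` the slide extension of the
rescaled diffeotopy `u ↦ F_{us}`. [folklore] -/
def extTrackFun (p : ℝ × M) : ℝ × M :=
  (p.1, c.slideExtensionFun (D.rescale p.1) p.2)

/-- The inverse track `(s, p) ↦ (s, G_s⁻¹ p)`. [folklore] -/
def extTrackInv (p : ℝ × M) : ℝ × M :=
  (p.1, c.slideExtensionInv (D.rescale p.1) p.2)

/-- The inverse track is a left inverse of the track. [folklore] -/
theorem extTrackInv_extTrackFun (p : ℝ × M) : c.extTrackInv D (c.extTrackFun D p) = p := by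
  simp only [extTrackFun, extTrackInv, c.slideExtensionInv_slideExtensionFun]

/-- The inverse track is a right inverse of the track. [folklore] -/
theorem extTrackFun_extTrackInv (p : ℝ × M) : c.extTrackFun D (c.extTrackInv D p) = p := by
  simp only [extTrackFun, extTrackInv, c.slideExtensionFun_slideExtensionInv]

/-- The track is level-preserving. [folklore] -/
@[simp] theorem extTrackFun_fst (p : ℝ × M) : (c.extTrackFun D p).1 = p.1 := rfl

/-- On the collar the track is explicit: `(s, c (y, r)) ↦ (s, c (F_{β(r) s} y, r))`. [folklore] -/
theorem extTrackFun_apply (s : ℝ) (q : b.carrier × Set.Icc (0 : ℝ) 1) :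
    c.extTrackFun D (s, c q) = (s, c (D.toFun (collarProfile q.2 * s) q.1, q.2)) := by
  simp only [extTrackFun, c.slideExtensionFun_apply]
  rfl

/-- On the collar the inverse track is explicit. [folklore] -/
theorem extTrackInv_apply (s : ℝ) (q : b.carrier × Set.Icc (0 : ℝ) 1) :
    c.extTrackInv D (s, c q) = (s, c (D.invFun (collarProfile q.2 * s) q.1, q.2)) := by
  simp only [extTrackInv, c.slideExtensionInv_apply]
  rfl

/-- Off the lower half of the collar the track is the identity. [folklore] -/
theorem extTrackFun_eq_self {p : ℝ × M}
    (hp : p.2 ∉ c '' {q : b.carrier × Set.Icc (0 : ℝ) 1 | (q.2 : ℝ) ≤ 1 / 2}) :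
    c.extTrackFun D p = p :=
  Prod.ext rfl (c.slideExtensionFun_eq_self _ hp)

/-- Off the lower half of the collar the inverse track is the identity. [folklore] -/
theorem extTrackInv_eq_self {p : ℝ × M}
    (hp : p.2 ∉ c '' {q : b.carrier × Set.Icc (0 : ℝ) 1 | (q.2 : ℝ) ≤ 1 / 2}) :
    c.extTrackInv D p = p :=
  Prod.ext rfl (c.slideExtensionInv_eq_self _ hp)

/-- At time `0` the track is the identity (`F_0 = id`). [folklore] -/
theorem extTrackFun_zero (x : M) : c.extTrackFun D (0, x) = (0, x) := by
  by_cases hx : x ∈ range c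
  · obtain ⟨q, rfl⟩ := hx
    rw [extTrackFun_apply, mul_zero, D.toFun_zero]
    rfl
  · exact Prod.ext rfl (c.slideExtensionFun_of_not_mem _ hx)

/-- On the boundary the track is the track of `F`: `(s, incl y) ↦ (s, incl (F_s y))`.
[folklore] -/
theorem extTrackFun_incl (s : ℝ) (y : b.carrier) :
    c.extTrackFun D (s, b.incl y) = (s, b.incl (D.toFun s y)) := by
  simp only [extTrackFun, c.slideExtensionFun_incl, Diffeotopy.rescale_toFun, one_mul]

/-! ### Smoothness of the track -/

variable [IsManifold I ∞ M]

/-- The open immersion `id × c : ℝ × (∂M × [0, 1]) → ℝ × M` along which smoothness descends.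
[folklore] -/
theorem isImmersionAt_prodMap_collar (p : ℝ × (b.carrier × Set.Icc (0 : ℝ) 1)) :
    Manifold.IsImmersionAt (𝓘(ℝ, ℝ).prod (I₀.prod (𝓡∂ 1))) (𝓘(ℝ, ℝ).prod I) ∞
      (Prod.map id c : ℝ × (b.carrier × Set.Icc (0 : ℝ) 1) → ℝ × M) p :=
  (Manifold.IsSmoothEmbedding.id.prodMap c.isSmoothEmbedding).isImmersion.isImmersionAt p

omit [IsManifold I ∞ M] in
/-- `id × c` maps neighbourhoods of `(s, q)`, `q` below the top, to neighbourhoods. [folklore] -/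
theorem image_prodMap_collar_mem_nhds {p : ℝ × (b.carrier × Set.Icc (0 : ℝ) 1)}
    (hp : (p.2.2 : ℝ) < 1) {U : Set _} (hU : U ∈ 𝓝 p) :
    (Prod.map id c : ℝ × (b.carrier × Set.Icc (0 : ℝ) 1) → ℝ × M) '' U ∈ 𝓝 (Prod.map id c p) := by
  obtain ⟨U₁, hU₁, U₂, hU₂, hsub⟩ := mem_nhds_prod_iff.1 hU
  have h2 : c '' U₂ ∈ 𝓝 (c p.2) := c.image_mem_nhds hp hU₂
  refine Filter.mem_of_superset (prod_mem_nhds hU₁ h2) ?_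
  rintro ⟨s, x⟩ ⟨hs, q, hq, rfl⟩
  exact ⟨(s, q), hsub (mk_mem_prod hs hq), rfl⟩

omit [IsManifold I ∞ M] in
/-- The explicit formula `(s, (y, r)) ↦ (s, c (F_{β(r) s} y, r))` is smooth. [folklore] -/
theorem contMDiff_extTrack_formula :
    ContMDiff (𝓘(ℝ, ℝ).prod (I₀.prod (𝓡∂ 1))) (𝓘(ℝ, ℝ).prod I) ∞
      fun p : ℝ × (b.carrier × Set.Icc (0 : ℝ) 1) =>
        ((p.1, c (D.toFun (collarProfile p.2.2 * p.1) p.2.1, p.2.2)) : ℝ × M) := by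
  refine contMDiff_fst.prodMk (c.isSmoothEmbedding.contMDiff.comp ?_)
  refine ContMDiff.prodMk ?_ (contMDiff_snd.comp contMDiff_snd)
  -- `(s, (y, r)) ↦ F_{β(r) s} y = uncurry F (β r * s, y)`
  have ht : ContMDiff (𝓘(ℝ, ℝ).prod (I₀.prod (𝓡∂ 1))) 𝓘(ℝ, ℝ) ∞
      fun p : ℝ × (b.carrier × Set.Icc (0 : ℝ) 1) => collarProfile p.2.2 * p.1 := by
    have h1 : ContMDiff (𝓘(ℝ, ℝ).prod (I₀.prod (𝓡∂ 1))) 𝓘(ℝ, ℝ) ∞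
        fun p : ℝ × (b.carrier × Set.Icc (0 : ℝ) 1) => collarProfile p.2.2 :=
      contDiff_collarProfile.contMDiff.comp
        (contMDiff_subtype_coe_Icc.comp (contMDiff_snd.comp contMDiff_snd))
    have h2 : ContMDiff (𝓘(ℝ, ℝ).prod (I₀.prod (𝓡∂ 1))) 𝓘(ℝ, ℝ × ℝ) ∞
        fun p : ℝ × (b.carrier × Set.Icc (0 : ℝ) 1) => (collarProfile p.2.2, p.1) :=
      h1.prodMk_space contMDiff_fst
    exact contDiff_mul.contMDiff.comp h2
  exact D.contMDiff_uncurry_toFun.comp (ht.prodMk (contMDiff_fst.comp contMDiff_snd))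

omit [IsManifold I ∞ M] in
/-- The explicit formula of the inverse track is smooth. [folklore] -/
theorem contMDiff_extTrackInv_formula :
    ContMDiff (𝓘(ℝ, ℝ).prod (I₀.prod (𝓡∂ 1))) (𝓘(ℝ, ℝ).prod I) ∞
      fun p : ℝ × (b.carrier × Set.Icc (0 : ℝ) 1) =>
        ((p.1, c (D.invFun (collarProfile p.2.2 * p.1) p.2.1, p.2.2)) : ℝ × M) := by
  refine contMDiff_fst.prodMk (c.isSmoothEmbedding.contMDiff.comp ?_)
  refine ContMDiff.prodMk ?_ (contMDiff_snd.comp contMDiff_snd)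
  have ht : ContMDiff (𝓘(ℝ, ℝ).prod (I₀.prod (𝓡∂ 1))) 𝓘(ℝ, ℝ) ∞
      fun p : ℝ × (b.carrier × Set.Icc (0 : ℝ) 1) => collarProfile p.2.2 * p.1 := by
    have h1 : ContMDiff (𝓘(ℝ, ℝ).prod (I₀.prod (𝓡∂ 1))) 𝓘(ℝ, ℝ) ∞
        fun p : ℝ × (b.carrier × Set.Icc (0 : ℝ) 1) => collarProfile p.2.2 :=
      contDiff_collarProfile.contMDiff.comp
        (contMDiff_subtype_coe_Icc.comp (contMDiff_snd.comp contMDiff_snd))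
    have h2 : ContMDiff (𝓘(ℝ, ℝ).prod (I₀.prod (𝓡∂ 1))) 𝓘(ℝ, ℝ × ℝ) ∞
        fun p : ℝ × (b.carrier × Set.Icc (0 : ℝ) 1) => (collarProfile p.2.2, p.1) :=
      h1.prodMk_space contMDiff_fst
    exact contDiff_mul.contMDiff.comp h2
  exact D.contMDiff_uncurry_invFun.comp (ht.prodMk (contMDiff_fst.comp contMDiff_snd))

variable [CompactSpace b.carrier] [T2Space M]

/-- **The track is smooth**: near a point of the lower half of the collar by descent along the
open immersion `id × c`, elsewhere it is locally the identity. [folklore] -/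
theorem contMDiff_extTrackFun :
    ContMDiff (𝓘(ℝ, ℝ).prod I) (𝓘(ℝ, ℝ).prod I) ∞ (c.extTrackFun D) := by
  rintro ⟨s, p⟩
  by_cases hp : p ∈ c '' {q : b.carrier × Set.Icc (0 : ℝ) 1 | (q.2 : ℝ) ≤ 1 / 2}
  · obtain ⟨q, hq, rfl⟩ := hp
    have hq1 : (q.2 : ℝ) < 1 := lt_of_le_of_lt hq (by norm_num)
    have h := contMDiffAt_of_comp_isImmersionAt_of_nhds (f := c.extTrackFun D)
      (c.isImmersionAt_prodMap_collar (s, q))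
      (fun U hU => c.image_prodMap_collar_mem_nhds (p := (s, q)) hq1 hU)
      ((c.contMDiff_extTrack_formula D).contMDiffAt) (fun p' => c.extTrackFun_apply D p'.1 p'.2)
    exact h
  · have hO : IsOpen ((univ : Set ℝ) ×ˢ (c '' {q : b.carrier × Set.Icc (0 : ℝ) 1 |
        (q.2 : ℝ) ≤ 1 / 2})ᶜ) := isOpen_univ.prod c.isClosed_image_lowerHalf.isOpen_compl
    have hev : c.extTrackFun D =ᶠ[𝓝 (s, p)] id :=
      Filter.eventuallyEq_of_mem (hO.mem_nhds ⟨mem_univ _, hp⟩)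
        fun p' hp' => c.extTrackFun_eq_self D hp'.2
    exact contMDiffAt_id.congr_of_eventuallyEq hev

/-- The inverse track is smooth. [folklore] -/
theorem contMDiff_extTrackInv :
    ContMDiff (𝓘(ℝ, ℝ).prod I) (𝓘(ℝ, ℝ).prod I) ∞ (c.extTrackInv D) := by
  rintro ⟨s, p⟩
  by_cases hp : p ∈ c '' {q : b.carrier × Set.Icc (0 : ℝ) 1 | (q.2 : ℝ) ≤ 1 / 2}
  · obtain ⟨q, hq, rfl⟩ := hp
    have hq1 : (q.2 : ℝ) < 1 := lt_of_le_of_lt hq (by norm_num)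
    have h := contMDiffAt_of_comp_isImmersionAt_of_nhds (f := c.extTrackInv D)
      (c.isImmersionAt_prodMap_collar (s, q))
      (fun U hU => c.image_prodMap_collar_mem_nhds (p := (s, q)) hq1 hU)
      ((c.contMDiff_extTrackInv_formula D).contMDiffAt) (fun p' => c.extTrackInv_apply D p'.1 p'.2)
    exact h
  · have hO : IsOpen ((univ : Set ℝ) ×ˢ (c '' {q : b.carrier × Set.Icc (0 : ℝ) 1 |
        (q.2 : ℝ) ≤ 1 / 2})ᶜ) := isOpen_univ.prod c.isClosed_image_lowerHalf.isOpen_compl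
    have hev : c.extTrackInv D =ᶠ[𝓝 (s, p)] id :=
      Filter.eventuallyEq_of_mem (hO.mem_nhds ⟨mem_univ _, hp⟩)
        fun p' hp' => c.extTrackInv_eq_self D hp'.2
    exact contMDiffAt_id.congr_of_eventuallyEq hev

/-! ### The extension -/

/-- **The diffeotopy of `M` extending the diffeotopy `F` of `∂M` over the collar `c`.**
[cite: Kosinski1993, VI §7 proof of (7.2)] -/
def diffeotopyExtension : Diffeotopy I M where
  track :=
    { toFun := c.extTrackFun D
      invFun := c.extTrackInv D
      left_inv := c.extTrackInv_extTrackFun D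
      right_inv := c.extTrackFun_extTrackInv D
      contMDiff_toFun := c.contMDiff_extTrackFun D
      contMDiff_invFun := c.contMDiff_extTrackInv D }
  track_fst _ := rfl
  track_zero x := by
    show (c.extTrackFun D (0, x)).2 = x
    rw [c.extTrackFun_zero D]

/-- Stages of the extension: the slide extensions of the rescaled diffeotopies. [folklore] -/
theorem diffeotopyExtension_toFun (s : ℝ) :
    (c.diffeotopyExtension D).toFun s = c.slideExtensionFun (D.rescale s) := rfl

/-- **The extension restricts to `F` on the boundary, at every time**:
`G_s (incl y) = incl (F_s y)`. [cite: Kosinski1993, VI §7 proof of (7.2)] -/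
theorem diffeotopyExtension_toFun_incl (s : ℝ) (y : b.carrier) :
    (c.diffeotopyExtension D).toFun s (b.incl y) = b.incl (D.toFun s y) := by
  show (c.extTrackFun D (s, b.incl y)).2 = _
  rw [c.extTrackFun_incl D]

/-- Functional form of `diffeotopyExtension_toFun_incl`. [folklore] -/
theorem diffeotopyExtension_toFun_comp_incl (s : ℝ) :
    (c.diffeotopyExtension D).toFun s ∘ b.incl = b.incl ∘ D.toFun s :=
  funext (c.diffeotopyExtension_toFun_incl D s)

end BoundaryData.Collar

/-- **Diffeotopies of a compact boundary extend to diffeotopies of the manifold, given a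
collar** (Kosinski 1993, VI §7, proof of (7.2): *"extended over `M`, using the collar of `∂M`,
in the usual way"*; Hirsch 1976, Ch. 8 §1 Thm. 1.6, §2 proof of Thm. 2.3): for every diffeotopy
`F` of `∂M` there is a diffeotopy `G` of `M` with `G_s ∘ incl = incl ∘ F_s` for all `s`.
[cite: Kosinski1993, VI §7 proof of (7.2)] -/
theorem BoundaryData.Collar.exists_diffeotopy_comp_incl_eq [IsManifold I ∞ M]
    [CompactSpace b.carrier] [T2Space M] (c : b.Collar) (D : Diffeotopy I₀ b.carrier) :
    ∃ G : Diffeotopy I M, ∀ s, G.toFun s ∘ b.incl = b.incl ∘ D.toFun s :=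
  ⟨c.diffeotopyExtension D, c.diffeotopyExtension_toFun_comp_incl D⟩

end General

/-! ### Compact manifolds with boundary in the Euclidean models -/

/-- **On a compact manifold with boundary (dimension `≥ 2`), every diffeotopy of the boundary
extends to a diffeotopy of the manifold**: collars exist
(`BoundaryData.nonempty_collar_of_compactSpace`, `CollarTheorem.lean`).
[cite: Kosinski1993, VI §7 proof of (7.2)] -/
theorem BoundaryData.exists_diffeotopy_comp_incl_eq_of_compactSpace (n : ℕ) {M : Type u}
    [TopologicalSpace M] [T2Space M] [CompactSpace M] [ChartedSpace (EuclideanHalfSpace (n + 2)) M]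
    [IsManifold (𝓡∂ (n + 2)) ∞ M] (b : BoundaryData (𝓡∂ (n + 2)) M (𝓡 (n + 1)))
    (D : Diffeotopy (𝓡 (n + 1)) b.carrier) :
    ∃ G : Diffeotopy (𝓡∂ (n + 2)) M, ∀ s, G.toFun s ∘ b.incl = b.incl ∘ D.toFun s := by
  haveI : CompactSpace b.carrier := b.compactSpace_carrier
  obtain ⟨c⟩ := BoundaryData.nonempty_collar_of_compactSpace n M b
  exact c.exists_diffeotopy_comp_incl_eq D

end Literature.Topology.FourManifolds

end
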